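import Mathlib
import HarnessLib
import Literature.Analysis.FluidPDE.Tao2016AveragedNS.LocalCascadeSolutions
import Literature.Analysis.FluidPDE.Tao2016AveragedNS.RenormalisedCascadeWaves
import Literature.Analysis.FluidPDE.Tao2016AveragedNS.ViscousEternalSolutions
import Literature.Analysis.FluidPDE.Tao2016AveragedNS.BoundedEternalSolutions
import Summits.NavierStokesRegularity.NavierStokesRegularity.Theorems.TaoLadderRungTwoBreakNoSurvivingEternalViscBddOneTailAction
import Summits.NavierStokesRegularity.NavierStokesRegularity.Theorems.TaoLadderRungTwoBreakNoSurvivingEternalViscBddOneTailBarrierOrthant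
import Summits.NavierStokesRegularity.NavierStokesRegularity.Theorems.TaoLadderRungTwoBreakNoSurvivingEternalViscBddOneTailConveyor

/-!
# Crux K1ᵛ(1) `TaoLadderRungTwoBreak.NoSurvivingEternalViscBddOne` (stmt-NavierStokesRegularity-20419):
# (S₁)-SURVIVAL IS LOUD — on the sign-coherent / strong-orthant class (incl. the dyadic member) a forward
# (S₁)-surviving bounded admissible eternal solution reaches a definite renormalised amplitude on EVERY shell

MODEL lattice ODEs only (Tao 2016 §4 in the self-similar log-time variables of §6.4); nothing in this file
is a statement about the Navier–Stokes equations, and no summit or rung LEAF is proved by it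
(`--supports stmt-NavierStokesRegularity-20419 --as helper`).  `C_A = fluxConst α`, `Λ = bigLam ε₀`.

Assembly of three landed facts: the tree's TAIL CONVEYOR (`…TailConveyor.frequently_largeAction_of_survivingFwd`:
survival ⇒ infinitely many bonds with action `> Λ/(4C_A(1+ε₀))`), this hand's ACTION FENCE (`…TailAction`:
`(3/4)∫‖W_k‖ ≤ ‖W_k(s₀)‖ + ΛC_A·M_{k-1}·∫‖W_{k-1}‖` on sign-coherent bonds) and LOUD DOWN-SET
(`…TailBarrierOrthant.loud_downset_of_flux_nonneg`).

* `action_le_sup_mul_action_real` — whole-line action fence: for a sign-coherent bond and a shell that vanishes at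
  `-∞`, `(3/4)∫_ℝ‖W_k‖ ≤ Λ C_A · M · ∫_ℝ‖W_{k-1}‖` whenever `‖W_{k-1}‖ ≤ M`;
* `exists_loud_below_of_largeAction` — a bond that is expensive relative to the one below
  (`ΛC_A·q·∫‖W_{k-1}‖ < (3/4)∫‖W_k‖`) forces `‖W_{k-1}(s)‖ > q` at some `s`;
* `survivingFwd_loud_everywhere_of_flux_nonneg` — **(S₁)-SURVIVAL ⇒ EVERY SHELL IS LOUD**: for a uniformly
  bounded admissible eternal solution (any `ν̂ ≥ 0`, cancelling table) with non-negative bond pairings, shells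
  vanishing at `-∞`, actions `∫‖W_n‖ ≤ M_act` and forward (S₁)-survival, EVERY shell `j` satisfies
  `‖W_j(s)‖ > q⋆ := min(3/(16 C_A²(1+ε₀) M_act), 1/(4Λ(C_A+1)))` at some log-time;
* `orthant_survivingFwd_loud_everywhere`, `dyadic_survivingFwd_loud_everywhere` — BY NAME on strong-orthant
  tables (pairing sign from route WakeRatchet's `physFlux_nonneg`, decay at `-∞` from `farPastDecay_all` /
  `tendsto_norm_atBot_of_isEternal`) and on `dyadicTable`: **every (S₁)-surviving admissible inviscid eternal
  solution of the Katz–Pavlović chain reaches amplitude `q⋆(ε₀, M_act)` on every shell**.  Contrapositive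
  (`dyadic_not_survivingFwd_of_quietShell`): ONE shell that stays below `q⋆` at all log-times excludes
  (S₁)-survival — the inviscid, amplitude analogue on the orthant class of the tree's viscous
  `SurvivingIffLoud.not_survivingFwd_of_quietShell`.

HONEST LABEL: `q⋆` depends on the action bound (survival at large action is not excluded: that is the wall
(N3)); the stubs `stub_noSurvivingEternalBddOne` / `stub_noLoudLadderOne` and ⟨20419⟩ stay OPEN; rung 0.
-/

noncomputable section

-- the summit and its single sub-problem share the name (CONVENTIONS §1)
set_option linter.dupNamespace false

namespace Summit.NavierStokesRegularity.NavierStokesRegularity.Theorems.NoSurvivingEternalViscBddOne.TailBarrier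

open Set Filter Topology MeasureTheory intervalIntegral
open scoped RealInnerProductSpace
open Literature.Analysis.FluidPDE Literature.Analysis.FluidPDE.TaoCascade
open Summit.NavierStokesRegularity.NavierStokesRegularity.Theorems.NoSurvivingEternalViscBddOne.TailConveyor
  (frequently_largeAction_of_survivingFwd)
open Summit.NavierStokesRegularity.NavierStokesRegularity.Theorems.WakeRatchetOrthant
  (quasiPositive_iff_strongOrthant uniformBound_of_orthant quasiPositive_dyadicTable)

variable {m : ℕ} {ε₀ νh : ℝ} {α : Fin m → Fin m → Fin m → ℤ × ℤ × ℤ → ℝ} {W : ℤ → ℝ → Em m}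

/-! ## The whole-line action fence -/

/-- **Whole-line action fence** (sign-coherent bond, any `ν̂ ≥ 0`): if the bond above shell `k` never
backscatters, `‖W_{k-1}‖ ≤ M` at all log-times and `‖W_k(s)‖ → 0` as `s → -∞`, then
`(3/4) ∫_ℝ ‖W_k‖ ≤ Λ C_A · M · ∫_ℝ ‖W_{k-1}‖`.
[cite: Tao2016AveragedNS, §1.2, §4 (4.1), (4.3), Lemma 4.1 (4.8); §6.4] -/
theorem action_le_sup_mul_action_real (hε : 0 < ε₀) (hW : IsEternalVisc ε₀ νh α W) (hc : IsCancellingCoeff α)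
    {k : ℤ} {M : ℝ} (hM : ∀ s, ‖W (k - 1) s‖ ≤ M)
    (hflux : ∀ s, 0 ≤ ⟪W (k + 1) s, tableA α (W k s)⟫)
    (hdec : Tendsto (fun s => ‖W k s‖) atBot (𝓝 0)) :
    (3 / 4) * ∫ s, ‖W k s‖ ≤ bigLam ε₀ * fluxConst α * M * ∫ s, ‖W (k - 1) s‖ := by
  have hΛ : 0 < bigLam ε₀ := bigLam_pos (by linarith)
  have hCA : 0 ≤ fluxConst α := fluxConst_nonneg α
  have hM0 : 0 ≤ M := (norm_nonneg _).trans (hM 0)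
  obtain ⟨Mact, hact⟩ := hW.action
  have hintk : Integrable (fun s => ‖W k s‖) := (hact k).1
  have hintk1 : Integrable (fun s => ‖W (k - 1) s‖) := (hact (k - 1)).1
  -- on every window [-j, j]
  have hwin : ∀ j : ℕ, (3 / 4) * ∫ s in (-(j : ℝ))..(j : ℝ), ‖W k s‖
      ≤ ‖W k (-(j : ℝ))‖ + bigLam ε₀ * fluxConst α * M * ∫ s, ‖W (k - 1) s‖ := by
    intro j
    have hj : (-(j : ℝ)) ≤ (j : ℝ) := by
      have : (0 : ℝ) ≤ j := Nat.cast_nonneg j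
      linarith
    have h1 := action_le_sup_mul_action hε hW hc hj (fun s _ _ => hM s)
      (fun s _ _ => by
        have := hflux s
        have h2 : 0 ≤ ‖W k s‖ ^ 2 / 2 := by positivity
        have h3 : 0 ≤ 2 * (bigLam ε₀)⁻¹ * ⟪W (k + 1) s, tableA α (W k s)⟫ := by positivity
        linarith)
    have h2 : ∫ s in (-(j : ℝ))..(j : ℝ), ‖W (k - 1) s‖ ≤ ∫ s, ‖W (k - 1) s‖ := by
      rw [intervalIntegral.integral_of_le hj]
      exact setIntegral_le_integral hintk1 (Eventually.of_forall fun s => norm_nonneg _)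
    have h3 : bigLam ε₀ * fluxConst α * M * ∫ s in (-(j : ℝ))..(j : ℝ), ‖W (k - 1) s‖
        ≤ bigLam ε₀ * fluxConst α * M * ∫ s, ‖W (k - 1) s‖ :=
      mul_le_mul_of_nonneg_left h2 (by positivity)
    linarith
  -- pass to the limit j → ∞
  have hlim1 : Tendsto (fun j : ℕ => (3 / 4) * ∫ s in (-(j : ℝ))..(j : ℝ), ‖W k s‖) atTop
      (𝓝 ((3 / 4) * ∫ s, ‖W k s‖)) := by
    refine Tendsto.const_mul _ ?_
    exact intervalIntegral_tendsto_integral hintk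
      (tendsto_neg_atTop_atBot.comp tendsto_natCast_atTop_atTop) tendsto_natCast_atTop_atTop
  have hlim2 : Tendsto (fun j : ℕ => ‖W k (-(j : ℝ))‖ + bigLam ε₀ * fluxConst α * M * ∫ s, ‖W (k - 1) s‖)
      atTop (𝓝 (0 + bigLam ε₀ * fluxConst α * M * ∫ s, ‖W (k - 1) s‖)) := by
    refine Tendsto.add_const _ ?_
    exact hdec.comp (tendsto_neg_atTop_atBot.comp tendsto_natCast_atTop_atTop)
  rw [zero_add] at hlim2
  exact le_of_tendsto_of_tendsto' hlim1 hlim2 hwin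

/-- **An expensive bond forces the shell below to be loud**: in the setting of `action_le_sup_mul_action_real`,
if `Λ C_A · q · ∫_ℝ‖W_{k-1}‖ < (3/4) ∫_ℝ‖W_k‖` then `‖W_{k-1}(s)‖ > q` at some log-time `s`.
[cite: Tao2016AveragedNS, §1.2, §4 (4.1), (4.3), Lemma 4.1 (4.8); §5; §6.4] -/
theorem exists_loud_below_of_largeAction (hε : 0 < ε₀) (hW : IsEternalVisc ε₀ νh α W)
    (hc : IsCancellingCoeff α) {k : ℤ} {q : ℝ}
    (hflux : ∀ s, 0 ≤ ⟪W (k + 1) s, tableA α (W k s)⟫)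
    (hdec : Tendsto (fun s => ‖W k s‖) atBot (𝓝 0))
    (hA : bigLam ε₀ * fluxConst α * q * ∫ s, ‖W (k - 1) s‖ < (3 / 4) * ∫ s, ‖W k s‖) :
    ∃ s, q < ‖W (k - 1) s‖ := by
  by_contra hcon
  push Not at hcon
  have := action_le_sup_mul_action_real hε hW hc hcon hflux hdec
  linarith

/-! ## Survival is loud on the sign-coherent class -/

/-- **(S₁)-SURVIVAL ⇒ EVERY SHELL IS LOUD (sign-coherent class, any `ν̂ ≥ 0`).**  Let `W` be a uniformly bounded
admissible eternal solution with covariant viscosity of a cancelling table, with non-negative bond pairings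
`⟪W_{k+1}, A W_k⟫ ≥ 0`, every shell vanishing at `-∞`, and per-shell actions `∫‖W_n‖ ≤ M_act` (`M_act > 0`).
If `W` is forward (S₁)-surviving then EVERY shell `j` reaches amplitude
`> q⋆ = min(3/(16 C_A² (1+ε₀) M_act), 1/(4Λ(C_A+1)))` at some log-time.
[cite: Tao2016AveragedNS, §1.2, §4 (4.1), (4.3), Lemma 4.1 (4.8)–(4.10), the viscous equation before Thm. 4.2, §6.4] -/
theorem survivingFwd_loud_everywhere_of_flux_nonneg (hε : 0 < ε₀) (hW : IsEternalVisc ε₀ νh α W)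
    (hc : IsCancellingCoeff α) (hU : UniformBound W)
    (hflux : ∀ (k : ℤ) (s : ℝ), 0 ≤ ⟪W (k + 1) s, tableA α (W k s)⟫)
    (hdec : ∀ k : ℤ, Tendsto (fun s => ‖W k s‖) atBot (𝓝 0))
    {Mact : ℝ} (hMact : 0 < Mact) (hact : ∀ n : ℤ, ∫ s, ‖W n s‖ ≤ Mact)
    (hS : EternalSurvivingFwd 1 ε₀ W) :
    ∀ j : ℤ, ∃ s : ℝ,
      min (3 / (16 * fluxConst α ^ 2 * (1 + ε₀) * Mact)) (1 / (4 * bigLam ε₀ * (fluxConst α + 1)))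
        < ‖W j s‖ := by
  have hΛ1 : 1 ≤ bigLam ε₀ := one_le_bigLam hε.le
  have hΛ : 0 < bigLam ε₀ := by linarith
  have hCA : 0 ≤ fluxConst α := fluxConst_nonneg α
  obtain ⟨B, hB⟩ := hU
  have hfreq := frequently_largeAction_of_survivingFwd hε hW hc ⟨B, hB⟩ hS (by norm_num : (1 / 2 : ℝ) < 1)
  -- the flux constant is positive (else no bond is ever expensive)
  rcases eq_or_lt_of_le hCA with hCA0 | hCApos
  · exfalso
    obtain ⟨n, -, hn⟩ := frequently_atTop.1 hfreq 0
    rw [← hCA0] at hn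
    simp at hn
    linarith
  set qs : ℝ := 3 / (16 * fluxConst α ^ 2 * (1 + ε₀) * Mact) with hqs
  set q₀ : ℝ := 1 / (4 * bigLam ε₀ * (fluxConst α + 1)) with hq₀
  set q : ℝ := min qs q₀ with hq
  have hqs0 : 0 < qs := by rw [hqs]; positivity
  have hq00 : 0 < q₀ := by rw [hq₀]; positivity
  have hq0 : 0 < q := lt_min hqs0 hq00
  -- the down-set condition at level q
  have hq2 : 2 * bigLam ε₀ * fluxConst α * q ^ 2 < q := by
    have hqle : q ≤ q₀ := min_le_right _ _
    have hqd : q₀ * (4 * bigLam ε₀ * (fluxConst α + 1)) = 1 := by rw [hq₀]; field_simp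
    have h1 : 2 * bigLam ε₀ * fluxConst α * q₀ < 1 := by nlinarith [mul_pos hΛ hq00]
    have h2 : 2 * bigLam ε₀ * fluxConst α * q ≤ 2 * bigLam ε₀ * fluxConst α * q₀ :=
      mul_le_mul_of_nonneg_left hqle (by positivity)
    nlinarith
  intro j
  -- an expensive bond above shell max(j, 0) + 1
  obtain ⟨n, hnj, hn⟩ := frequently_atTop.1 hfreq j.toNat
  -- a_{n+1} > Λ/(4 C_A (1+ε₀))
  have hbig : bigLam ε₀ / (4 * fluxConst α * (1 + ε₀)) < ∫ s, ‖W ((n : ℤ) + 1) s‖ := by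
    rw [div_lt_iff₀ (by positivity)]
    have h1 : (1 : ℝ) / 2 * bigLam ε₀ < (1 + ε₀) * (2 * fluxConst α * (bigLam ε₀)⁻¹
        * ∫ s, ‖W ((n : ℤ) + 1) s‖) * bigLam ε₀ := mul_lt_mul_of_pos_right hn hΛ
    have h2 : (1 + ε₀) * (2 * fluxConst α * (bigLam ε₀)⁻¹ * ∫ s, ‖W ((n : ℤ) + 1) s‖) * bigLam ε₀
        = 2 * ((∫ s, ‖W ((n : ℤ) + 1) s‖) * (fluxConst α * (1 + ε₀))) := by
      field_simp
    rw [h2] at h1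
    linarith
  -- shell n is loud at level qs
  have hloud : ∃ s, qs < ‖W (n : ℤ) s‖ := by
    have hk : ((n : ℤ) + 1) - 1 = (n : ℤ) := by ring
    have h := exists_loud_below_of_largeAction hε hW hc (k := (n : ℤ) + 1) (q := qs)
      (hflux ((n : ℤ) + 1)) (hdec ((n : ℤ) + 1)) ?_
    · rwa [hk] at h
    rw [hk]
    have h1 : bigLam ε₀ * fluxConst α * qs * ∫ s, ‖W (n : ℤ) s‖
        ≤ bigLam ε₀ * fluxConst α * qs * Mact :=
      mul_le_mul_of_nonneg_left (hact n) (by positivity)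
    have h2 : bigLam ε₀ * fluxConst α * qs * Mact = 3 * bigLam ε₀ / (16 * fluxConst α * (1 + ε₀)) := by
      rw [hqs]; field_simp
    have h3 : 3 * bigLam ε₀ / (16 * fluxConst α * (1 + ε₀))
        = (3 / 4) * (bigLam ε₀ / (4 * fluxConst α * (1 + ε₀))) := by
      field_simp; ring
    have h4 : (3 / 4) * (bigLam ε₀ / (4 * fluxConst α * (1 + ε₀))) < (3 / 4) * ∫ s, ‖W ((n : ℤ) + 1) s‖ :=
      mul_lt_mul_of_pos_left hbig (by norm_num)
    linarith
  obtain ⟨s, hs⟩ := hloud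
  have hsq : q < ‖W (n : ℤ) s‖ := lt_of_le_of_lt (min_le_left _ _) hs
  -- the loud down-set
  have hjn : j ≤ (n : ℤ) := by omega
  obtain ⟨s', -, hs'⟩ := loud_downset_of_flux_nonneg hε hW hc hB hflux hq2 (σ₁ := s) le_rfl hsq j hjn
  exact ⟨s', hs'⟩

/-! ## By name: strong-orthant tables and the dyadic member -/

/-- On a strong-orthant table every shell of a uniformly bounded admissible eternal solution (any `ν̂ ≥ 0`)
vanishes at `σ → -∞` (`ν̂ = 0`: the action clause, `tendsto_norm_atBot_of_isEternal`; `ν̂ > 0`: the tree's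
`farPastDecay_all`).
[cite: Tao2016AveragedNS, §4 Lemma 4.1 (4.8)–(4.10), §6.4; tree `farPastDecay_all`] -/
theorem tendsto_norm_atBot_of_uniformBound (hε : 0 < ε₀) (hW : IsEternalVisc ε₀ νh α W)
    (hc : IsCancellingCoeff α) {B : ℝ} (hB : ∀ (k : ℤ) (σ : ℝ), ‖W k σ‖ ≤ B) (k : ℤ) :
    Tendsto (fun s => ‖W k s‖) atBot (𝓝 0) := by
  rcases eq_or_lt_of_le hW.nonneg with hν0 | hνpos
  · -- inviscid
    have hE : IsEternal ε₀ α W := by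
      have h := hW
      rw [← hν0] at h
      exact isEternalVisc_zero_iff.1 h
    exact tendsto_norm_atBot_of_isEternal hε hE hB k
  · -- viscous: squeeze with the far-past decay
    set K : ℝ := fluxConst α * bigLam ε₀ * B ^ 2 / (νh * (1 + ε₀) ^ ((2 : ℝ) * (k : ℝ))) with hK
    have hKpos : 0 < νh * (1 + ε₀) ^ ((2 : ℝ) * (k : ℝ)) := mul_pos hνpos (Real.rpow_pos_of_pos (by linarith) _)
    have hbound : ∀ s, ‖W k s‖ ≤ K * Real.exp s := by
      intro s
      have h := farPastDecay_all hε hνpos hW hc hB k s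
      rw [hK]
      calc ‖W k s‖ ≤ fluxConst α * bigLam ε₀ * B ^ 2 * Real.exp s / (νh * (1 + ε₀) ^ ((2 : ℝ) * (k : ℝ))) := h
        _ = fluxConst α * bigLam ε₀ * B ^ 2 / (νh * (1 + ε₀) ^ ((2 : ℝ) * (k : ℝ))) * Real.exp s := by
            ring
    have hlim : Tendsto (fun s => K * Real.exp s) atBot (𝓝 0) := by
      have := Real.tendsto_exp_atBot.const_mul K
      simpa using this
    exact tendsto_of_tendsto_of_tendsto_of_le_of_le' tendsto_const_nhds hlim
      (Eventually.of_forall fun s => norm_nonneg _) (Eventually.of_forall hbound)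

/-- **(S₁)-SURVIVAL IS LOUD ON STRONG-ORTHANT TABLES, by name** (any `ν̂ ≥ 0`, cancelling table): a uniformly
bounded admissible eternal solution with actions `≤ M_act` that is forward (S₁)-surviving reaches amplitude
`> min(3/(16 C_A²(1+ε₀) M_act), 1/(4Λ(C_A+1)))` on EVERY shell.
[cite: Tao2016AveragedNS, §1.2, §4 Thm. 4.2 (statement shape), Lemma 4.1 (4.8)–(4.10), §6.4] -/
theorem orthant_survivingFwd_loud_everywhere (hε : 0 < ε₀) (hW : IsEternalVisc ε₀ νh α W)
    (hc : IsCancellingCoeff α)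
    (hA : ∀ (i : Fin m) (y : Em m), 0 ≤ tableA α y i)
    (hQ : ∀ (i : Fin m) (x : Em m), x i = 0 → 0 ≤ tableQ α x i)
    (hBk : ∀ (i : Fin m) (z x : Em m), x i = 0 → tableB α z x i = 0)
    (hU : UniformBound W) {Mact : ℝ} (hMact : 0 < Mact) (hact : ∀ n : ℤ, ∫ s, ‖W n s‖ ≤ Mact)
    (hS : EternalSurvivingFwd 1 ε₀ W) :
    ∀ j : ℤ, ∃ s : ℝ,
      min (3 / (16 * fluxConst α ^ 2 * (1 + ε₀) * Mact)) (1 / (4 * bigLam ε₀ * (fluxConst α + 1)))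
        < ‖W j s‖ := by
  obtain ⟨B, hB⟩ := hU
  exact survivingFwd_loud_everywhere_of_flux_nonneg hε hW hc ⟨B, hB⟩
    (fun k s => inner_tableA_nonneg_of_orthant hε hW hA hQ hBk k s)
    (fun k => tendsto_norm_atBot_of_uniformBound hε hW hc hB k) hMact hact hS

/-- **THE DYADIC MEMBER: (S₁)-survival is loud on every shell.**  Every forward (S₁)-surviving admissible
inviscid eternal solution of the Katz–Pavlović chain `dyadicTable` with per-shell actions `≤ M_act` reaches
amplitude `> min(3/(16 C_A²(1+ε₀) M_act), 1/(4Λ(C_A+1)))` (`C_A = fluxConst dyadicTable`) on EVERY shell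
(uniform boundedness is automatic on the class, `WakeRatchetOrthant.uniformBound_of_orthant`).
[cite: Tao2016AveragedNS, §1.2 (the dyadic Katz–Pavlović model), §4 Thm. 4.2 (statement shape), §6.4] -/
theorem dyadic_survivingFwd_loud_everywhere (hε : 0 < ε₀) {W : ℤ → ℝ → Em 4}
    (hW : IsEternal ε₀ dyadicTable W) {Mact : ℝ} (hMact : 0 < Mact)
    (hact : ∀ n : ℤ, ∫ s, ‖W n s‖ ≤ Mact) (hS : EternalSurvivingFwd 1 ε₀ W) :
    ∀ j : ℤ, ∃ s : ℝ,
      min (3 / (16 * fluxConst dyadicTable ^ 2 * (1 + ε₀) * Mact))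
          (1 / (4 * bigLam ε₀ * (fluxConst dyadicTable + 1))) < ‖W j s‖ := by
  obtain ⟨hA, hQ, hBk⟩ := (quasiPositive_iff_strongOrthant dyadicTable).1 quasiPositive_dyadicTable
  have hα : InTableClass 2 dyadicTable := inTableClass_dyadicTable le_rfl
  have hU : UniformBound W := uniformBound_of_orthant hε hα.2.1 hW hA hQ hBk
  exact orthant_survivingFwd_loud_everywhere hε hW.isEternalVisc hα.2.1 hA hQ hBk hU hMact hact hS

/-- **The dyadic member: one amplitude-quiet shell excludes (S₁)-survival.**  If some shell `j` of an admissible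
inviscid eternal solution of `dyadicTable` with actions `≤ M_act` stays at amplitude
`≤ min(3/(16 C_A²(1+ε₀) M_act), 1/(4Λ(C_A+1)))` at ALL log-times, the solution is not forward (S₁)-surviving.
[cite: Tao2016AveragedNS, §1.2, §4 Thm. 4.2 (statement shape), §6.4] -/
theorem dyadic_not_survivingFwd_of_quietShell (hε : 0 < ε₀) {W : ℤ → ℝ → Em 4}
    (hW : IsEternal ε₀ dyadicTable W) {Mact : ℝ} (hMact : 0 < Mact)
    (hact : ∀ n : ℤ, ∫ s, ‖W n s‖ ≤ Mact) {j : ℤ}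
    (hquiet : ∀ s : ℝ, ‖W j s‖ ≤ min (3 / (16 * fluxConst dyadicTable ^ 2 * (1 + ε₀) * Mact))
          (1 / (4 * bigLam ε₀ * (fluxConst dyadicTable + 1)))) :
    ¬ EternalSurvivingFwd 1 ε₀ W := by
  intro hS
  obtain ⟨s, hs⟩ := dyadic_survivingFwd_loud_everywhere hε hW hMact hact hS j
  exact absurd (hquiet s) (not_le.2 hs)

end Summit.NavierStokesRegularity.NavierStokesRegularity.Theorems.NoSurvivingEternalViscBddOne.TailBarrier

end
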